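import Summits.QuantumFields.YangMills.Theorems.NPointIsotropy.Negative.TieLoadBearing
import Summits.QuantumFields.YangMills.Theorems.CurvatureBoostCovariance.Negative.Unbundled
import Literature.MathematicalPhysics.QuantumFieldTheory.OSLorentzInvariance

/-!
# `PencilRigidity.NPointIsotropy`, line `complex-rotation-bandlimit`: helpers for the mop-up stub `stub_mopup`, I

Support file (helpers, part I) for stub `stub_mopup` of crux `stmt-QuantumFields-11686`
(`Summit.QuantumFields.YangMills.Theses.PencilRigidity.NPointIsotropy`), line `complex-rotation-bandlimit`; the
stub itself is proved in `PencilRigidityNPointIsotropyMopup.lean`. Everything lives in the sub-namespace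
`…NPointIsotropy.ComplexRotationBandlimit.Mopup` (no collisions with sibling stub files of the line); no `def`.

Contents (all folklore; `E4 = ℝ⁴`, configurations `x : Fin n → E4`, `π` = projection to the `(x₀,x₁)`-plane):
* `exists_eq_planeRot` — **`SO(2)₀₁ = {planeRot 0 φ}`**: a determinant-one linear isometry `R` of `ℝ⁴` fixing
  `e₂, e₃` is the plane rotation `planeRot 0 φ` for some angle. `R e₀, R e₁` are orthonormal and orthogonal to
  `e₂ = R e₂`, `e₃ = R e₃`, so `R e₀ = (a, b, 0, 0)`, `R e₁ = (p, q, 0, 0)` with `a² + b² = p² + q² = 1`,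
  `ap + bq = 0`; the determinant is `aq - bp` (`det_eq_of_fix`, Laplace expansion of the explicit `4 × 4` matrix in
  the standard basis), and `aq - bp = 1` forces `(p, q) = (-b, a)`; with `cos φ = a`, `sin φ = -b`
  (`exists_cos_eq_and_sin_eq`, via `Complex.arg`) both isometries agree on the standard basis.
* `measurePreserving_diag`, `integral_mul_linActMulti` — the diagonal action of an isometry on `(ℝ⁴)ⁿ` preserves
  Lebesgue measure; `∫ W(Lx) F(x) dx = ∫ W(x) (L·F)(x) dx`.
* Null sets: `volume_setOf_coord_eq` (a coordinate hyperplane `{x_k^r = x_l^r}`, `k ≠ l`, is null — a proper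
  linear subspace, `Measure.addHaar_submodule`), `volume_setOf_planar_eq` (an affine planar line condition
  `{y | w₀y₀ + w₁y₁ = c}`, `w ≠ 0`, is null in `ℝ⁴`), `volume_eq_zero_of_slices` (Fubini for null sets on `(ℝ⁴)ⁿ`
  one point at a time, via `lmarginal`: if the `xₘ`-slices of `Z` are null outside an `m`-independent null set,
  `Z` is null), and the goal of this file, `volume_pairing_eq_zero`: **for `i ≠ j`, `k ≠ l` the quadric
  `{x | ⟨π(xᵢ-xⱼ), π(x_k-x_l)⟩ = 0}` is Lebesgue-null** (its `xᵢ`- or `xⱼ`-slices are affine planar lines off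
  `{π x_k = π x_l}`; if `{i,j} = {k,l}` it is `{π xᵢ = π xⱼ}`).

References: folklore.
-/

noncomputable section

namespace Summit.QuantumFields.YangMills.Theorems.NPointIsotropy.ComplexRotationBandlimit

open scoped BigOperators SchwartzMap InnerProductSpace Topology ENNReal
open MeasureTheory Filter
open Literature.MathematicalPhysics.QuantumLattice Literature.MathematicalPhysics.AQFT
  Literature.MathematicalPhysics.QuantumFieldTheory
open Summit.QuantumFields.YangMills.Theorems.NPointIsotropy.Negative (E4)
open Summit.QuantumFields.YangMills.Theorems.CurvatureBoostCovariance.Negative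
  (PlanarInvariant isOffDiagonal_linActMulti)

namespace Mopup

variable {n : ℕ}

/-! ## `SO(2)₀₁`: determinant-one isometries fixing `e₂, e₃` are the plane rotations `planeRot 0 φ` -/

/-- A point of the unit circle is `(cos φ, sin φ)`. [folklore] -/
theorem exists_cos_eq_and_sin_eq {a b : ℝ} (h : a ^ 2 + b ^ 2 = 1) :
    ∃ φ : ℝ, Real.cos φ = a ∧ Real.sin φ = b := by
  set z : ℂ := ⟨a, b⟩ with hz
  have hzn : ‖z‖ = 1 := by
    rw [Complex.norm_def, Complex.normSq_mk, ← sq, ← sq, h, Real.sqrt_one]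
  have hz0 : z ≠ 0 := by
    intro h0
    rw [h0, norm_zero] at hzn
    exact zero_ne_one hzn
  exact ⟨Complex.arg z, by rw [Complex.cos_arg hz0, hzn, div_one], by
    rw [Complex.sin_arg, hzn, div_one]⟩

/-- Determinant of an isometry of `ℝ⁴` fixing `e₂, e₃`, in terms of the images of `e₀, e₁`. [folklore] -/
theorem det_eq_of_fix (R : E4 ≃ₗᵢ[ℝ] E4)
    (h2 : R (EuclideanSpace.single 2 1) = EuclideanSpace.single 2 1)
    (h3 : R (EuclideanSpace.single 3 1) = EuclideanSpace.single 3 1) :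
    LinearMap.det (R.toLinearEquiv : E4 →ₗ[ℝ] E4) =
      R (EuclideanSpace.single 0 1) 0 * R (EuclideanSpace.single 1 1) 1 -
        R (EuclideanSpace.single 0 1) 1 * R (EuclideanSpace.single 1 1) 0 := by
  set b := (EuclideanSpace.basisFun (Fin 4) ℝ).toBasis with hb
  set u := R (EuclideanSpace.single 0 1) with hu
  set v := R (EuclideanSpace.single 1 1) with hv
  have hM : LinearMap.toMatrix b b (R.toLinearEquiv : E4 →ₗ[ℝ] E4) =
      !![u 0, v 0, 0, 0; u 1, v 1, 0, 0; u 2, v 2, 1, 0; u 3, v 3, 0, 1] := by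
    ext i j
    rw [LinearMap.toMatrix_apply, hb, OrthonormalBasis.coe_toBasis_repr_apply,
      EuclideanSpace.basisFun_repr, OrthonormalBasis.coe_toBasis, EuclideanSpace.basisFun_apply,
      LinearEquiv.coe_coe, LinearIsometryEquiv.coe_toLinearEquiv]
    fin_cases i <;> fin_cases j <;> simp [h2, h3, hu, hv]
  have h12 : Fin.succAbove (1 : Fin 4) (2 : Fin 3) = 3 := by decide
  rw [← LinearMap.det_toMatrix b, hM]
  simp [Matrix.det_succ_row_zero, Fin.sum_univ_succ, h12]
  ring

/-- **`SO(2)₀₁ = {planeRot 0 φ}`**: a determinant-one linear isometry of `ℝ⁴` fixing `e₂` and `e₃` is the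
rotation `planeRot 0 φ` of the `(x₀,x₁)`-plane for some angle `φ`. [folklore] -/
theorem exists_eq_planeRot (R : E4 ≃ₗᵢ[ℝ] E4)
    (hdet : LinearMap.det (R.toLinearEquiv : E4 →ₗ[ℝ] E4) = 1)
    (h2 : R (EuclideanSpace.single 2 1) = EuclideanSpace.single 2 1)
    (h3 : R (EuclideanSpace.single 3 1) = EuclideanSpace.single 3 1) :
    ∃ φ : ℝ, R = planeRot (d := 3) 0 φ := by
  set u := R (EuclideanSpace.single 0 1) with hu
  set v := R (EuclideanSpace.single 1 1) with hv
  -- the images of `e₀, e₁` lie in the `(x₀,x₁)`-plane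
  have hu2 : u 2 = 0 := by
    have h := R.inner_map_map (EuclideanSpace.single 0 1) (EuclideanSpace.single 2 1)
    rw [h2, ← hu] at h
    simpa [EuclideanSpace.inner_single_right] using h
  have hu3 : u 3 = 0 := by
    have h := R.inner_map_map (EuclideanSpace.single 0 1) (EuclideanSpace.single 3 1)
    rw [h3, ← hu] at h
    simpa [EuclideanSpace.inner_single_right] using h
  have hv2 : v 2 = 0 := by
    have h := R.inner_map_map (EuclideanSpace.single 1 1) (EuclideanSpace.single 2 1)
    rw [h2, ← hv] at h
    simpa [EuclideanSpace.inner_single_right] using h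
  have hv3 : v 3 = 0 := by
    have h := R.inner_map_map (EuclideanSpace.single 1 1) (EuclideanSpace.single 3 1)
    rw [h3, ← hv] at h
    simpa [EuclideanSpace.inner_single_right] using h
  -- they are orthonormal
  have hun : u 0 ^ 2 + u 1 ^ 2 = 1 := by
    have h : ‖u‖ ^ 2 = 1 := by
      rw [hu, LinearIsometryEquiv.norm_map, PiLp.norm_single, norm_one, one_pow]
    rw [EuclideanSpace.norm_sq_eq] at h
    simpa [Fin.sum_univ_four, hu2, hu3] using h
  have hvn : v 0 ^ 2 + v 1 ^ 2 = 1 := by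
    have h : ‖v‖ ^ 2 = 1 := by
      rw [hv, LinearIsometryEquiv.norm_map, PiLp.norm_single, norm_one, one_pow]
    rw [EuclideanSpace.norm_sq_eq] at h
    simpa [Fin.sum_univ_four, hv2, hv3] using h
  have huv : u 0 * v 0 + u 1 * v 1 = 0 := by
    have h : ⟪u, v⟫_ℝ = 0 := by
      rw [hu, hv, LinearIsometryEquiv.inner_map_map]
      simp [EuclideanSpace.inner_single_left]
    rw [PiLp.inner_apply] at h
    simpa [Fin.sum_univ_four, hu2, hu3, mul_comm] using h
  -- determinant one forces `v = (-u₁, u₀)`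
  have hd : u 0 * v 1 - u 1 * v 0 = 1 := by rw [← det_eq_of_fix R h2 h3, hdet]
  have hq : v 1 = u 0 := by
    linear_combination u 0 * hd + u 1 * huv - v 1 * hun
  have hp : v 0 = -u 1 := by
    linear_combination (-u 1) * hd + u 0 * huv - v 0 * hun
  -- the angle
  have hun' : u 0 ^ 2 + (-u 1) ^ 2 = 1 := by rw [neg_sq]; exact hun
  obtain ⟨φ, hc, hs⟩ := exists_cos_eq_and_sin_eq hun'
  refine ⟨φ, ?_⟩
  have hlin : (R.toLinearEquiv : E4 →ₗ[ℝ] E4) =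
      ((planeRot (d := 3) 0 φ).toLinearEquiv : E4 →ₗ[ℝ] E4) := by
    refine (EuclideanSpace.basisFun (Fin 4) ℝ).toBasis.ext fun i => ?_
    simp only [OrthonormalBasis.coe_toBasis, EuclideanSpace.basisFun_apply,
      LinearEquiv.coe_coe, LinearIsometryEquiv.coe_toLinearEquiv]
    ext j
    fin_cases i <;> fin_cases j <;>
      simp [planeRot_apply, ← hu, ← hv, hu2, hu3, hv2, hv3, hp, hq, hc, hs, h2, h3]
  ext x : 1
  exact LinearMap.congr_fun hlin x

/-! ## Change of variables under the diagonal action -/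

/-- The diagonal action `x ↦ (L x_k)_k` of a linear isometry on `(ℝ⁴)ⁿ` preserves Lebesgue measure. [folklore] -/
theorem measurePreserving_diag (L : E4 ≃ₗᵢ[ℝ] E4) :
    MeasurePreserving (fun (x : Fin n → E4) (k : Fin n) => L (x k)) :=
  volume_preserving_pi fun _ => L.measurePreserving

/-- Change of variables by an isometry acting diagonally on `n`-point configurations:
`∫ W(Lx) F(x) dx = ∫ W(x) F(L⁻¹x) dx`. [folklore] -/
theorem integral_mul_linActMulti (L : E4 ≃ₗᵢ[ℝ] E4) (W : (Fin n → E4) → ℂ)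
    (F : 𝓢((Fin n → E4), ℂ)) :
    ∫ y : Fin n → E4, W (fun k => L (y k)) * F y = ∫ x : Fin n → E4, W x * linActMulti L F x := by
  have hme : MeasurableEmbedding (fun (x : Fin n → E4) (k : Fin n) => L (x k)) :=
    (MeasurableEquiv.piCongrRight fun _ : Fin n =>
      L.toHomeomorph.toMeasurableEquiv).measurableEmbedding
  rw [← (measurePreserving_diag L).integral_comp hme (fun x => W x * linActMulti L F x)]
  congr 1
  funext y
  simp [linActMulti_apply]

/-! ## Null sets: coordinate hyperplanes, planar lines, and the planar quadrics -/

/-- A coordinate hyperplane `{x_k^r = x_l^r}` (`k ≠ l`) of the configuration space `(ℝ⁴)ⁿ` is Lebesgue-null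
(a proper linear subspace). [folklore] -/
theorem volume_setOf_coord_eq (k l : Fin n) (hkl : k ≠ l) (r : Fin 4) :
    volume {x : Fin n → E4 | x k r = x l r} = 0 := by
  set g : (Fin n → E4) →ₗ[ℝ] ℝ :=
    ((EuclideanSpace.proj r).comp (ContinuousLinearMap.proj k) -
      (EuclideanSpace.proj r).comp (ContinuousLinearMap.proj l) : (Fin n → E4) →L[ℝ] ℝ).toLinearMap
    with hg
  have hg_apply : ∀ x : Fin n → E4, g x = x k r - x l r := fun x => rfl
  have hset : {x : Fin n → E4 | x k r = x l r} = (LinearMap.ker g : Set (Fin n → E4)) := by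
    ext x
    simp only [Set.mem_setOf_eq, SetLike.mem_coe, LinearMap.mem_ker, hg_apply, sub_eq_zero]
  have hne : LinearMap.ker g ≠ ⊤ := by
    intro htop
    have hx : (Pi.single k (EuclideanSpace.single r (1 : ℝ)) : Fin n → E4) ∈ LinearMap.ker g := by
      rw [htop]; exact Submodule.mem_top
    rw [LinearMap.mem_ker, hg_apply] at hx
    simp [hkl.symm] at hx
  rw [hset]
  exact Measure.addHaar_submodule volume _ hne

/-- An affine line condition in the `(x₀,x₁)`-plane cuts out a Lebesgue-null subset of `ℝ⁴`:
`{y | w₀ y₀ + w₁ y₁ = c}` is null for `(w₀, w₁) ≠ 0`. [folklore] -/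
theorem volume_setOf_planar_eq (w₀ w₁ c : ℝ) (hw : w₀ ≠ 0 ∨ w₁ ≠ 0) :
    volume {y : E4 | w₀ * y 0 + w₁ * y 1 = c} = 0 := by
  set f : E4 →ₗ[ℝ] ℝ :=
    ((w₀ • (EuclideanSpace.proj 0 : E4 →L[ℝ] ℝ)) + (w₁ • (EuclideanSpace.proj 1 : E4 →L[ℝ] ℝ))).toLinearMap
    with hf
  have hf_apply : ∀ y : E4, f y = w₀ * y 0 + w₁ * y 1 := fun y => rfl
  have hne : LinearMap.ker f ≠ ⊤ := by
    intro htop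
    have h0 : (EuclideanSpace.single 0 (1 : ℝ) : E4) ∈ LinearMap.ker f := by
      rw [htop]; exact Submodule.mem_top
    have h1 : (EuclideanSpace.single 1 (1 : ℝ) : E4) ∈ LinearMap.ker f := by
      rw [htop]; exact Submodule.mem_top
    rw [LinearMap.mem_ker, hf_apply] at h0 h1
    simp at h0 h1
    rcases hw with h | h
    · exact h h0
    · exact h h1
  by_cases hS : ({y : E4 | w₀ * y 0 + w₁ * y 1 = c} : Set E4).Nonempty
  · obtain ⟨p, hp⟩ := hS
    have hset : {y : E4 | w₀ * y 0 + w₁ * y 1 = c} =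
        (fun y : E4 => -p + y) ⁻¹' (LinearMap.ker f : Set E4) := by
      ext y
      simp only [Set.mem_setOf_eq, Set.mem_preimage, SetLike.mem_coe, LinearMap.mem_ker, hf_apply,
        PiLp.add_apply, PiLp.neg_apply]
      simp only [Set.mem_setOf_eq] at hp
      constructor
      · intro h; linear_combination h - hp
      · intro h; linear_combination h + hp
    rw [hset, measure_preimage_add]
    exact Measure.addHaar_submodule volume _ hne
  · rw [Set.not_nonempty_iff_eq_empty] at hS
    rw [hS, measure_empty]

/-- **Fubini for null sets on `(ℝ⁴)ⁿ`, one point at a time.** If the slices of a measurable set `Z` in the `m`-th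
point are null outside an `m`-independent null set `B`, then `Z` is null. [folklore] -/
theorem volume_eq_zero_of_slices (m : Fin n) {Z B : Set (Fin n → E4)} (hZ : MeasurableSet Z)
    (hB : MeasurableSet B) (hB0 : volume B = 0)
    (hBm : ∀ (x : Fin n → E4) (y : E4), Function.update x m y ∈ B ↔ x ∈ B)
    (hslice : ∀ x ∉ B, volume {y : E4 | Function.update x m y ∈ Z} = 0) : volume Z = 0 := by
  classical
  set f : (Fin n → E4) → ℝ≥0∞ := Z.indicator 1 with hf
  set g : (Fin n → E4) → ℝ≥0∞ := B.indicator (fun _ => ∞) with hg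
  have hfm : Measurable f := measurable_one.indicator hZ
  have hgm : Measurable g := measurable_const.indicator hB
  have hle : ∫⋯∫⁻_{m}, f ∂(fun _ : Fin n => (volume : Measure E4)) ≤
      ∫⋯∫⁻_{m}, g ∂(fun _ : Fin n => (volume : Measure E4)) := by
    rw [lmarginal_singleton, lmarginal_singleton]
    intro x
    dsimp only
    by_cases hx : x ∈ B
    · -- the right-hand side is `∞`
      have hgx : ∀ y : E4, g (Function.update x m y) = ∞ := fun y => by
        simp [hg, (hBm x y).2 hx]
      simp only [hgx, lintegral_const]
      rw [ENNReal.top_mul (NeZero.ne _)]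
      exact le_top
    · -- the left-hand side is the measure of the slice, which vanishes
      have hfx : (fun y : E4 => f (Function.update x m y)) =
          {y : E4 | Function.update x m y ∈ Z}.indicator 1 := by
        funext y
        simp [hf, Set.indicator]
      have hmeas : MeasurableSet {y : E4 | Function.update x m y ∈ Z} :=
        hZ.preimage (measurable_update x)
      calc ∫⁻ y, f (Function.update x m y) ∂(volume : Measure E4)
          = ∫⁻ y, {y : E4 | Function.update x m y ∈ Z}.indicator 1 y ∂(volume : Measure E4) := by
            rw [hfx]
        _ = volume {y : E4 | Function.update x m y ∈ Z} := lintegral_indicator_one hmeas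
        _ = 0 := hslice x hx
        _ ≤ _ := bot_le
  have h := lintegral_le_of_lmarginal_le (μ := fun _ : Fin n => (volume : Measure E4)) {m} hfm hgm hle
  rw [← volume_pi, hf, hg, lintegral_indicator_one hZ, lintegral_indicator_const hB, hB0,
    mul_zero] at h
  exact nonpos_iff_eq_zero.1 h

/-- The coordinate maps `x ↦ x_m^r` on `(ℝ⁴)ⁿ` are continuous. [folklore] -/
theorem continuous_coord (m : Fin n) (r : Fin 4) : Continuous fun x : Fin n → E4 => x m r :=
  (EuclideanSpace.proj r).continuous.comp (continuous_apply m)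

/-- The planar pairing `⟨π(xᵢ - xⱼ), π(x_k - x_l)⟩` (`π` = projection to the `(x₀,x₁)`-plane) is continuous. [folklore] -/
theorem continuous_pairing (i j k l : Fin n) :
    Continuous fun x : Fin n → E4 =>
      (x i 0 - x j 0) * (x k 0 - x l 0) + (x i 1 - x j 1) * (x k 1 - x l 1) :=
  ((((continuous_coord i 0).sub (continuous_coord j 0)).mul
    ((continuous_coord k 0).sub (continuous_coord l 0))).add
    (((continuous_coord i 1).sub (continuous_coord j 1)).mul
      ((continuous_coord k 1).sub (continuous_coord l 1))))

/-- **The planar quadrics are null, main case** (`i ∉ {j, k, l}`): the zero set of `⟨π(xᵢ - xⱼ), π(x_k - x_l)⟩`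
is Lebesgue-null in `(ℝ⁴)ⁿ` — its slices in the point `xᵢ` are affine planar lines as soon as `π x_k ≠ π x_l`, and
`{π x_k = π x_l}` is null. [folklore] -/
theorem volume_pairing_eq_zero_of_ne (i j k l : Fin n) (hji : j ≠ i) (hki : k ≠ i) (hli : l ≠ i)
    (hkl : k ≠ l) :
    volume {x : Fin n → E4 |
      (x i 0 - x j 0) * (x k 0 - x l 0) + (x i 1 - x j 1) * (x k 1 - x l 1) = 0} = 0 := by
  set P : (Fin n → E4) → ℝ := fun x =>
    (x i 0 - x j 0) * (x k 0 - x l 0) + (x i 1 - x j 1) * (x k 1 - x l 1) with hP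
  have hPc : Continuous P := continuous_pairing i j k l
  set B : Set (Fin n → E4) := {x | x k 0 = x l 0 ∧ x k 1 = x l 1} with hB
  have hBmeas : MeasurableSet B :=
    ((isClosed_eq (continuous_coord k 0) (continuous_coord l 0)).inter
      (isClosed_eq (continuous_coord k 1) (continuous_coord l 1))).measurableSet
  refine volume_eq_zero_of_slices i (isClosed_eq hPc continuous_const).measurableSet hBmeas
    (measure_mono_null (fun x hx => hx.1) (volume_setOf_coord_eq k l hkl 0)) (fun x y => ?_) ?_
  · simp [hB, Function.update_of_ne hki, Function.update_of_ne hli]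
  · intro x hx
    have hw : x k 0 - x l 0 ≠ 0 ∨ x k 1 - x l 1 ≠ 0 := by
      by_contra h
      simp only [not_or, not_not, sub_eq_zero] at h
      exact hx h
    have hset : {y : E4 | Function.update x i y ∈ {x | P x = 0}} =
        {y : E4 | (x k 0 - x l 0) * y 0 + (x k 1 - x l 1) * y 1 =
          (x k 0 - x l 0) * x j 0 + (x k 1 - x l 1) * x j 1} := by
      ext y
      simp only [Set.mem_setOf_eq, hP, Function.update_self, Function.update_of_ne hji,
        Function.update_of_ne hki, Function.update_of_ne hli]
      constructor
      · intro h; linear_combination h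
      · intro h; linear_combination h
    rw [hset]
    exact volume_setOf_planar_eq _ _ _ hw

/-- **The planar quadrics are null**: for `i ≠ j`, `k ≠ l` the zero set of `⟨π(xᵢ - xⱼ), π(x_k - x_l)⟩` is
Lebesgue-null in `(ℝ⁴)ⁿ` (main case in `xᵢ` or, after the antisymmetry `i ↔ j`, in `xⱼ`; if `{i,j} = {k,l}` the
zero set is `{π xᵢ = π xⱼ}`, inside a coordinate hyperplane). [folklore] -/
theorem volume_pairing_eq_zero (i j k l : Fin n) (hij : i ≠ j) (hkl : k ≠ l) :
    volume {x : Fin n → E4 |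
      (x i 0 - x j 0) * (x k 0 - x l 0) + (x i 1 - x j 1) * (x k 1 - x l 1) = 0} = 0 := by
  by_cases hi : k ≠ i ∧ l ≠ i
  · exact volume_pairing_eq_zero_of_ne i j k l hij.symm hi.1 hi.2 hkl
  by_cases hj : k ≠ j ∧ l ≠ j
  · have hset : {x : Fin n → E4 |
        (x i 0 - x j 0) * (x k 0 - x l 0) + (x i 1 - x j 1) * (x k 1 - x l 1) = 0} =
        {x : Fin n → E4 |
          (x j 0 - x i 0) * (x k 0 - x l 0) + (x j 1 - x i 1) * (x k 1 - x l 1) = 0} := by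
      ext x
      simp only [Set.mem_setOf_eq]
      constructor
      · intro h; linear_combination -h
      · intro h; linear_combination -h
    rw [hset]
    exact volume_pairing_eq_zero_of_ne j i k l hij hj.1 hj.2 hkl
  · -- `{i, j} = {k, l}`: the pairing is `±|π(xᵢ - xⱼ)|²`
    refine measure_mono_null (fun x hx => ?_) (volume_setOf_coord_eq i j hij 0)
    simp only [not_and_or, not_not] at hi hj
    simp only [Set.mem_setOf_eq] at hx ⊢
    have key : (x i 0 - x j 0) ^ 2 + (x i 1 - x j 1) ^ 2 = 0 := by
      rcases hi with hk | hl <;> rcases hj with hk' | hl'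
      · exact absurd (hk.symm.trans hk') hij
      · rw [hk, hl'] at hx; linear_combination hx
      · rw [hl, hk'] at hx; linear_combination -hx
      · exact absurd (hl.symm.trans hl') hij
    have h0 := ((add_eq_zero_iff_of_nonneg (sq_nonneg _) (sq_nonneg _)).1 key).1
    exact sub_eq_zero.1 ((pow_eq_zero_iff two_ne_zero).1 h0)

end Mopup

/-- **Registered sub-goal of stub `stub_mopup` (helpers, part I)**: for `i ≠ j`, `k ≠ l` the planar quadric
`{x | ⟨π(xᵢ - xⱼ), π(x_k - x_l)⟩ = 0}` is Lebesgue-null in `(ℝ⁴)ⁿ` — the complement of the planar-generic set is a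
finite union of these. [folklore] -/
theorem mopupGenericNull :
    ∀ (n : ℕ) (i j k l : Fin n), i ≠ j → k ≠ l →
      MeasureTheory.volume {x : Fin n → EuclideanSpace ℝ (Fin 4) |
        (x i 0 - x j 0) * (x k 0 - x l 0) + (x i 1 - x j 1) * (x k 1 - x l 1) = 0} = 0 :=
  fun _ i j k l hij hkl => Mopup.volume_pairing_eq_zero i j k l hij hkl

end Summit.QuantumFields.YangMills.Theorems.NPointIsotropy.ComplexRotationBandlimit

end
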